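import Mathlib
import Literature.Geometry.Lorentzian.ReggeWheelerChannels
import Literature.Geometry.Lorentzian.ReggeWheelerTortoise
import Summits.FinalStateConjecture.FinalStateConjecture.Theorems.UniformPhotonSphereChannels.Negative.NearKernelStatic
import Summits.FinalStateConjecture.FinalStateConjecture.Theorems.PhotonSphereChannelsRWPotential
import Summits.FinalStateConjecture.FinalStateConjecture.Theorems.PhotonSphereChannelsExteriorEnergyRW

/-!
# Crux `UniformPhotonSphereChannels` (K1, item stmt-FinalStateConjecture-10045), line
# `kruskal-rest-frame-virial` — Stub 3: the near-side kernel census over the Regge–Wheeler vocabulary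

Support file (does not close the item).  The registered stub `stub_nearKernelCensus` of the line's
skeleton: along a tortoise radius function `r` (`IsTortoiseRadius M r xc`), `s ≤ ℓ`, every element `p`
of the candidate non-radiative kernel `rwKernel (linePotential M s ℓ r) xc ρ` (a `C²` `t`-polynomial
solution of `p_tt − p_xx + V_{s,ℓ}(r x) p = 0` on the open exterior cone) whose energy at `t = 0` on
the near half-line `(−∞, xc − ρ)` is finite has ZERO velocity trace there:
`deriv (fun τ => p τ x) 0 = 0` for `x < xc − ρ`.

This is an adapter on the landed census `KernelCensus.static_of_finite_energy`
(`Theorems/UniformPhotonSphereChannels/Negative/NearKernelStatic.lean`), instantiated with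
`e₀ = xc − ρ`, `V = linePotential M s ℓ r`:

* the near cone `{x + |t| < xc − ρ}` lies in the exterior cone `{ρ + |t| < |x − xc|}`
  (`nearCone_subset_exteriorCone`), so the three clauses of `p ∈ rwKernel …` restrict to it;
* `V` is `C¹` (indeed `C^∞`: `r` is smooth by `tortoise_contDiff`, `r > 2M > 0`), non-negative
  (`linePotential_nonneg`), and exponentially small at the horizon end,
  `V x ≤ C · exp(x/(2M))` (`rwPotential_tortoise_le_exp`);
* the census makes `p` static on the near cone, so for `x < xc − ρ` the slice `τ ↦ p τ x` agrees with
  the constant `p 0 x` on the neighbourhood `|τ| < xc − ρ − x` of `0`, whence its derivative at `0`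
  vanishes (`Filter.EventuallyEq.deriv_eq`, `deriv_const`).

[folklore; the flat foil is Kenig–Lawrie–Liu–Schlag, Adv. Math. 285 (2015), §1 Remark 5]
-/

namespace Summit.FinalStateConjecture.FinalStateConjecture.Theorems.KruskalRestFrameVirial

open Literature.Geometry.Lorentzian Literature.Geometry.Lorentzian.ReggeWheeler MeasureTheory Filter Set
open Literature.Barriers.FinalStateConjecture
open scoped ENNReal Topology

noncomputable section

variable {M : ℝ} {r : ℝ → ℝ} {xc : ℝ}

/-- The near cone `{x + |t| < xc − ρ}` lies inside the exterior cone `{ρ + |t| < |x − xc|}`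
(no sign condition on `ρ`: `|x − xc| ≥ xc − x`). [folklore] -/
theorem nearCone_subset_exteriorCone (xc ρ : ℝ) :
    {z : ℝ × ℝ | z.2 + |z.1| < xc - ρ} ⊆ exteriorCone xc ρ := by
  intro z hz
  rw [mem_setOf_eq] at hz
  rw [mem_exteriorCone]
  have h1 : xc - z.2 ≤ |z.2 - xc| := by
    rw [abs_sub_comm]
    exact le_abs_self _
  linarith

/-- The Regge–Wheeler line potential along a tortoise radius function is `Cⁿ` for every `n`
(`r` is smooth and `r > 2M > 0`). [folklore] -/
theorem contDiff_linePotential (hr : IsTortoiseRadius M r xc) (s ℓ : ℕ) (n : ℕ∞) :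
    ContDiff ℝ n (linePotential M s ℓ r) := by
  have hrC : ContDiff ℝ n r :=
    tortoise_contDiff hr.mass_pos hr.two_mul_lt hr.hasDerivAt hr.center n
  have hr0 : ∀ x, r x ≠ 0 := fun x => (hr.pos x).ne'
  unfold linePotential rwPotential
  exact (contDiff_const.sub (contDiff_const.div hrC hr0)).mul
    ((contDiff_const.div (hrC.pow 2) fun x ↦ pow_ne_zero _ (hr0 x)).add
      (contDiff_const.div (hrC.pow 3) fun x ↦ pow_ne_zero _ (hr0 x)))

/-- **Horizon-side exponential smallness** of the line potential: along a tortoise radius function,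
`V_{s,ℓ}(r x) ≤ C · exp(x/(2M))` for all `x`, with an explicit `C = C(M, ℓ, xc) ≥ 0`
(from `rwPotential_tortoise_le_exp`). [folklore] -/
theorem linePotential_le_exp (hr : IsTortoiseRadius M r xc) (s ℓ : ℕ) :
    ∃ C : ℝ, 0 ≤ C ∧ ∀ x, linePotential M s ℓ r x ≤ C * Real.exp (1 / (2 * M) * x) := by
  have hM := hr.mass_pos
  refine ⟨((ℓ : ℝ) * ((ℓ : ℝ) + 1) + 1) / (2 * M) ^ 3
      * Real.exp ((-xc + efTortoiseCoord M (3 * M) - 2 * M) / (2 * M)), by positivity, fun x => ?_⟩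
  have h := rwPotential_tortoise_le_exp hM hr.two_mul_lt hr.hasDerivAt hr.center s ℓ x
  have hsplit : (x - xc + efTortoiseCoord M (3 * M) - 2 * M) / (2 * M)
      = (-xc + efTortoiseCoord M (3 * M) - 2 * M) / (2 * M) + 1 / (2 * M) * x := by
    field_simp
    ring
  rw [hsplit, Real.exp_add] at h
  simpa only [linePotential, rwPotential, mul_assoc] using h

/-- **Stub 3 — near-side kernel census.** Along a tortoise radius function and for `s ≤ ℓ`, a kernel
element `p ∈ rwKernel (linePotential M s ℓ r) xc ρ` with finite energy at `t = 0` on the near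
half-line `(−∞, xc − ρ)` has vanishing velocity trace there: `∂_t p(0, x) = 0` for `x < xc − ρ`.
(The census `KernelCensus.static_of_finite_energy` makes `p` static on the near cone
`{x + |t| < xc − ρ}`; the slice `τ ↦ p τ x` is then constant near `τ = 0`.)
[folklore; KenigEtAl2015 §1 Remark 5 is the flat foil] -/
theorem stub_nearKernelCensus {M : ℝ} {r : ℝ → ℝ} {xc : ℝ} (hr : IsTortoiseRadius M r xc)
    (s ℓ : ℕ) (hsℓ : s ≤ ℓ) (ρ : ℝ) (p : ℝ → ℝ → ℝ)
    (hp : p ∈ rwKernel (linePotential M s ℓ r) xc ρ)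
    (hfin : ∫⁻ x in Iio (xc - ρ),
      ENNReal.ofReal (energyDensity (linePotential M s ℓ r) p 0 x) < ∞) :
    ∀ x, x < xc - ρ → deriv (fun τ => p τ x) 0 = 0 := by
  obtain ⟨hpC, hpS, hpP⟩ := hp
  have hsub := nearCone_subset_exteriorCone xc ρ
  have hV : ContDiff ℝ 1 (linePotential M s ℓ r) := contDiff_linePotential hr s ℓ 1
  have hV0 : ∀ x, 0 ≤ linePotential M s ℓ r x :=
    fun x => linePotential_nonneg hr.mass_pos.le hsℓ hr.two_mul_lt x
  have hκ : 0 < 1 / (2 * M) := by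
    have hM := hr.mass_pos
    positivity
  obtain ⟨C, hC, hVexp⟩ := linePotential_le_exp hr s ℓ
  obtain ⟨N, a, ha⟩ := hpP
  have hstat := KernelCensus.static_of_finite_energy (V := linePotential M s ℓ r) (e₀ := xc - ρ)
    (p := p) hV hV0 hκ hC (fun x _ => hVexp x) (hpC.mono hsub) (fun z hz => hpS z (hsub hz))
    ⟨N, a, fun z hz => ha z (hsub hz)⟩ (by simpa only [energyDensity] using hfin)
  intro x hx
  have hε : 0 < xc - ρ - x := by linarith
  have hev : ∀ᶠ τ in 𝓝 (0 : ℝ), |τ| < xc - ρ - x := by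
    have hopen : IsOpen {τ : ℝ | |τ| < xc - ρ - x} := isOpen_lt continuous_abs continuous_const
    refine hopen.mem_nhds ?_
    rw [mem_setOf_eq, abs_zero]
    exact hε
  have hcongr : (fun τ => p τ x) =ᶠ[𝓝 0] fun _ => p 0 x := by
    filter_upwards [hev] with τ hτ
    exact hstat (τ, x) (by dsimp only; linarith)
  rw [hcongr.deriv_eq]
  exact deriv_const (0 : ℝ) (p 0 x)

end

end Summit.FinalStateConjecture.FinalStateConjecture.Theorems.KruskalRestFrameVirial
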